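import Literature.Probability.LatticeModels.KilledWalkHubFactorisation
import Literature.Probability.LatticeModels.KilledWalkGreen
import HarnessLib

/-!
# Wall-ball bounds for the hub factorisation of the exit kernel (line `symplectic-fermion-anchor`,
crux `SAWLoopFugacityFlow.AvoidanceLimit`, stmt-CriticalPhenomena-10649)

Two analytic bricks of the UPPER bound in Chelkak's factorisation `P_Λ(m,x) ≍ hitProb_{B*}(m) · P_Λ(u*,x)`
of the exit kernel `P = killedPoisson Gr Λ` of the edge-killed walk (walk on `ℤ²` along the edges of
`Gr`, killed at its first non-`Gr` step and on leaving the finite region `Λ`) through a hub box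
(Chelkak 2016, Proposition 3.1, proof of Lemma 3.2): after the separator decomposition
`killedPoisson_le_separator` the wall `W ⊆ V` is covered by small balls `Bf ⊆ V`, and the
contribution of one ball is controlled through the Green function `G = killedRegionGreen Gr Λ` at its
centre `c`.

* `hitProb_mul_le_killedRegionGreen` — **Green-function lower bound for hitting probabilities**: if
  `ℓ ≤ G(w,c)` for every `w ∈ B`, then `ℓ · hitProb_B(m) ≤ G(m,c)` for every `m` (`G(·,c)` is
  killed-superharmonic on `Λ`, `hitProb_B` is the killed-harmonic extension to `Λ ∖ B` of `𝟙_B`: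
  comparison principle on `Λ ∖ B`).
* `sum_killedPoisson_le_hitProb` — the entrance sum `∑_{w ∈ Bf} P_{Λ∖V}(m,w)` into `Bf ⊆ V` is at
  most `hitProb_{Bf}(m)` (comparison of two killed-harmonic functions on `Λ ∖ V`).
* `sum_killedPoisson_mul_le_of_ball` — the ball bound
  `∑_{w ∈ Bf} P_{Λ∖V}(m,w) P_Λ(w,x) ≤ (M/ℓ) · G(m,c)` when `P_Λ(·,x) ≤ M` and `G(·,c) ≥ ℓ > 0` on `Bf`.

Everything is proved from the maximum principle of `KilledWalkLaplacian.lean`. No definitions.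
Source: D. Chelkak, *Robust discrete complex analysis: a toolbox*, Ann. Probab. 44 (2016), §3.1–3.2
[Chelkak2016].
-/

noncomputable section

open scoped BigOperators Classical
open Finset
open Literature.Probability.LatticeModels

namespace Summit.CriticalPhenomena.SAWScalingLimit.Theorems.AvoidanceLimit.Anchor

/-- **Green-function lower bound for hitting probabilities.** For the edge-killed walk `Gr` in the
finite region `Λ`, a set `B` and a pole `c`: if `ℓ ≤ G_Λ(w,c)` for all `w ∈ B`, then
`ℓ · hitProb Gr Λ B m ≤ G_Λ(m,c)` for every `m` — on `Λ ∖ B` by the comparison principle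
(`ℓ · hitProb_B` is killed-harmonic, `G_Λ(·,c)` killed-superharmonic, and the inequality holds off
`Λ ∖ B`, where `hitProb_B = 𝟙_B` and `G_Λ ≥ 0`). [cite: Chelkak2016, Proposition 3.1] -/
theorem hitProb_mul_le_killedRegionGreen :
    ∀ (Gr : SimpleGraph (Site 2)) (Λ B : Set (Site 2)), Λ.Finite → B ⊆ Λ → ∀ (c : Site 2), c ∈ B →
      ∀ (ℓ : ℝ), (∀ w ∈ B, ℓ ≤ killedRegionGreen Gr Λ w c) →
      ∀ m : Site 2, ℓ * hitProb Gr Λ B m ≤ killedRegionGreen Gr Λ m c := by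
  intro Gr Λ B hΛ _ c _ ℓ hℓ m
  have hSfin : (Λ \ B).Finite := hΛ.subset fun _ hz => hz.1
  -- off `Λ ∖ B`: on `B` the hypothesis, elsewhere `hitProb = 0 ≤ G`
  have hoff : ∀ z, z ∉ Λ \ B → ℓ * hitProb Gr Λ B z ≤ killedRegionGreen Gr Λ z c := by
    intro z hz
    by_cases hzB : z ∈ B
    · rw [hitProb_of_mem hzB, mul_one]; exact hℓ z hzB
    · rw [hitProb_of_not_mem hz, if_neg hzB, mul_zero]
      exact killedRegionGreen_nonneg Λ z c
  by_cases hm : m ∈ Λ \ B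
  · have h1 : IsKilledHarmonicOn Gr (fun z => ℓ * hitProb Gr Λ B z) (Λ \ B) :=
      (hitProb_harmonicOn hΛ).const_mul ℓ
    have h2 : IsKilledSuperharmonicOn Gr (fun z => killedRegionGreen Gr Λ z c) (Λ \ B) :=
      fun v hv => killedRegionGreen_superharmonicOn hΛ c v hv.1
    exact le_of_killedSub_killedSuper_of_boundary hSfin h1.subharmonicOn h2
      (fun z hz => hoff z hz.1) m hm
  · exact hoff m hm

/-- **The entrance sum into a ball is a hitting probability.** For `Bf ⊆ V` and the walk killed on
leaving `Λ ∖ V`: `∑_{w ∈ Bf} P_{Λ∖V}(m,w) ≤ hitProb Gr Λ Bf m` — both sides are killed-harmonic on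
`Λ ∖ V`, and off `Λ ∖ V` the left side is `𝟙_{Bf}` while the right side is `1` on `Bf` and `≥ 0`.
[cite: Chelkak2016, §3.2] -/
theorem sum_killedPoisson_le_hitProb {Gr : SimpleGraph (Site 2)} {Λ V : Set (Site 2)} (hΛ : Λ.Finite)
    (Bf : Finset (Site 2)) (hBV : (↑Bf : Set (Site 2)) ⊆ V) (m : Site 2) :
    ∑ w ∈ Bf, killedPoisson Gr (Λ \ V) m w ≤ hitProb Gr Λ (↑Bf : Set (Site 2)) m := by
  have hSfin : (Λ \ V).Finite := hΛ.subset fun _ hz => hz.1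
  -- off `Λ ∖ V` the entrance sum is the indicator of `Bf`
  have hoff : ∀ z, z ∉ Λ \ V →
      ∑ w ∈ Bf, killedPoisson Gr (Λ \ V) z w ≤ hitProb Gr Λ (↑Bf : Set (Site 2)) z := by
    intro z hz
    by_cases hzB : z ∈ Bf
    · rw [Finset.sum_eq_single_of_mem z hzB fun w _ hwz => by
        rw [killedPoisson_of_not_mem hz, if_neg (Ne.symm hwz)]]
      rw [killedPoisson_of_not_mem hz, if_pos rfl, hitProb_of_mem (Finset.mem_coe.2 hzB)]
    · rw [Finset.sum_eq_zero fun w hw => by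
        rw [killedPoisson_of_not_mem hz, if_neg fun h => hzB (by rwa [h])]]
      exact hitProb_nonneg hΛ z
  by_cases hm : m ∈ Λ \ V
  · -- the entrance sum is killed-harmonic on `Λ ∖ V`
    have hF : IsKilledHarmonicOn Gr (fun z => ∑ w ∈ Bf, killedPoisson Gr (Λ \ V) z w) (Λ \ V) := by
      intro v hv
      show ∑ w ∈ Bf, killedPoisson Gr (Λ \ V) v w =
        killedAvg Gr (fun z => ∑ w ∈ Bf, killedPoisson Gr (Λ \ V) z w) v
      rw [killedAvg_finset_sum Gr Bf (fun w z => killedPoisson Gr (Λ \ V) z w) v]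
      exact Finset.sum_congr rfl fun w _ => killedPoisson_harmonicOn hSfin w v hv
    -- `hitProb_{Bf}` is killed-harmonic on `Λ ∖ Bf ⊇ Λ ∖ V`
    have hb : IsKilledHarmonicOn Gr (hitProb Gr Λ (↑Bf : Set (Site 2))) (Λ \ V) :=
      (hitProb_harmonicOn hΛ).mono fun z hz => ⟨hz.1, fun h => hz.2 (hBV h)⟩
    exact le_of_killedSub_killedSuper_of_boundary hSfin hF.subharmonicOn hb.superharmonicOn
      (fun z hz => hoff z hz.1) m hm
  · exact hoff m hm

/-- **The ball bound of the wall sum.** For `Bf ⊆ V ⊆ Λ` (finite), a centre `c ∈ Bf`, and constants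
`0 < ℓ ≤ min_{Bf} G_Λ(·,c)`, `max_{Bf} P_Λ(·,x) ≤ M` (`0 ≤ M`):
`∑_{w ∈ Bf} P_{Λ∖V}(m,w) P_Λ(w,x) ≤ (M/ℓ) · G_Λ(m,c)` for every `m` — bound `P_Λ(w,x) ≤ M`
termwise, the entrance sum by `hitProb_{Bf}(m)` (`sum_killedPoisson_le_hitProb`), and
`ℓ · hitProb_{Bf} ≤ G_Λ(·,c)` (`hitProb_mul_le_killedRegionGreen`).
[cite: Chelkak2016, Proposition 3.1 (proof of Lemma 3.2)] -/
theorem sum_killedPoisson_mul_le_of_ball :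
    ∀ (Gr : SimpleGraph (Site 2)) (Λ V : Set (Site 2)) (Bf : Finset (Site 2)), Λ.Finite →
      (↑Bf : Set (Site 2)) ⊆ V → V ⊆ Λ → ∀ (c x : Site 2), c ∈ Bf → ∀ (ℓ M : ℝ), 0 < ℓ → 0 ≤ M →
      (∀ w ∈ Bf, ℓ ≤ killedRegionGreen Gr Λ w c) → (∀ w ∈ Bf, killedPoisson Gr Λ w x ≤ M) →
      ∀ m : Site 2, ∑ w ∈ Bf, killedPoisson Gr (Λ \ V) m w * killedPoisson Gr Λ w x ≤
        M / ℓ * killedRegionGreen Gr Λ m c := by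
  intro Gr Λ V Bf hΛ hBV hVΛ c x hc ℓ M hℓ0 hM0 hℓ hM m
  have hSfin : (Λ \ V).Finite := hΛ.subset fun _ hz => hz.1
  -- (ii) `P_Λ(w,x) ≤ M` termwise
  have h1 : ∑ w ∈ Bf, killedPoisson Gr (Λ \ V) m w * killedPoisson Gr Λ w x ≤
      M * ∑ w ∈ Bf, killedPoisson Gr (Λ \ V) m w := by
    rw [Finset.mul_sum]
    refine Finset.sum_le_sum fun w hw => ?_
    rw [mul_comm M]
    exact mul_le_mul_of_nonneg_left (hM w hw) (killedPoisson_nonneg hSfin m w)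
  -- (i) the entrance sum is at most `hitProb_{Bf}(m)`
  have h2 : ∑ w ∈ Bf, killedPoisson Gr (Λ \ V) m w ≤ hitProb Gr Λ (↑Bf : Set (Site 2)) m :=
    sum_killedPoisson_le_hitProb hΛ Bf hBV m
  -- (iii) the Green-function lower bound for `hitProb_{Bf}`
  have h3 : ℓ * hitProb Gr Λ (↑Bf : Set (Site 2)) m ≤ killedRegionGreen Gr Λ m c :=
    hitProb_mul_le_killedRegionGreen Gr Λ (↑Bf) hΛ (hBV.trans hVΛ) c (Finset.mem_coe.2 hc) ℓ
      (fun w hw => hℓ w (Finset.mem_coe.1 hw)) m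
  calc ∑ w ∈ Bf, killedPoisson Gr (Λ \ V) m w * killedPoisson Gr Λ w x
      ≤ M * ∑ w ∈ Bf, killedPoisson Gr (Λ \ V) m w := h1
    _ ≤ M * hitProb Gr Λ (↑Bf : Set (Site 2)) m := mul_le_mul_of_nonneg_left h2 hM0
    _ = M / ℓ * (ℓ * hitProb Gr Λ (↑Bf : Set (Site 2)) m) := by field_simp
    _ ≤ M / ℓ * killedRegionGreen Gr Λ m c := mul_le_mul_of_nonneg_left h3 (div_nonneg hM0 hℓ0.le)

end Summit.CriticalPhenomena.SAWScalingLimit.Theorems.AvoidanceLimit.Anchor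

end
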